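import Literature.MathematicalPhysics.QuantumFieldTheory.Balaban1983to89.B3ScalarPropagatorMean

/-!
# `Balaban1983to89.B3ScalarPropagatorSource` — T. Bałaban, *(Higgs)₂,₃ quantum fields in a finite volume. III.
Renormalization*, Commun. Math. Phys. **88** (1983) 411–445 [Balaban1983Higgs3], Sect. 1 p. 415: **«… but we can easily add
the field G_k(Ω, B̃)f coming from external sources in the generating functional for Schwinger functions»** — PROVED for the
typed renormalization transformation of (1.4) (`B3Eq14AuxFunction.Data14.rt14`), as the source-term twin of
`B3ScalarPropagatorMean.rt14_gaussian_eq`: a linear source `e^{⟨φ′, f⟩}` in the generating functional, `f` supported in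
`Ω = B^k(Ω^{(k)})`, SHIFTS THE MEAN of the old field `φ′` by `G_k(Ω,B̃)f` — the external scalar field becomes
`φ′₀ + G_k(Ω,B̃)f = a_k(L^kη)^{−2}G_k(Ω,B̃)Q_k^*(B̃)(1_{Ω^{(k)}}φ) + G_k(Ω,B̃)f` — and produces the generating-function prefactor
`e^{⟨φ′₀, f⟩ + ½⟨f, G_k(Ω,B̃)f⟩}`; theorems only

statement-level skeleton of published theorems with citation tags; proofs where landed; nothing here is a claim about the Yang–Mills mass gap

PDFs held: `paper:balaban1983-higgs-2-3-quantum-fields-finite-volume` (journal page = PDF page + 410).  Read on the ×2 render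
`run/shared/lean/pub/pub-balaban/b2b-balaban-ref1/pages/1983-cmp88-higgs23-III/1983-cmp88-higgs23-III-p005-x2.png` (p. 415),
never from the OCR layer.

CITATION HEADER (lean-in-tree rule).  lit-balaban typed skeleton (HOME `run/shared/lean/pub/lit-balaban/`), typer line,
continuation of `B3ScalarPropagatorMean` (split off to respect the cell's file-length cap); located member of the SKELETON
row **B3.Eq1.12-1.15** (p. 414–415 paragraph «Next we have to describe propagators»; owner r15; cells only, zero head
weight).  THE SOURCE TEXT, p. 415 [PDF 5], verbatim: *"The external scalar field is a_kG_k(Ω, B̃)Q_k(B̃)φ or (1.12), but we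
can easily add the field G_k(Ω, B̃)f coming from external sources in the generating functional for Schwinger functions."*
⟦reading, as in `B3ScalarPropagatorMean`: `Q_k(B̃)φ` is print's shorthand for the adjoint `Q_k^*(B̃)φ` (paper I (3.29)); "the
generating functional for Schwinger functions" is the functional integral with a linear source term `e^{⟨φ′,f⟩}` in the old
field, `f` living on the region `Ω` of the `η`-lattice, whose derivatives in `f` are the Schwinger functions⟧.

WHAT IS PROVED (0 sorry; theorems only; nothing re-declared — `Data14.rt14/scalarOp/Ω`, `HiggsCovariance.covOpK/propagatorK/
avgQkAdj`, `HiggsFluctMeasure.coeff221`, `B1RT.prec`, `B3Eq14AuxFunction.extendZero` and the theorems of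
`B3ScalarPropagatorMean` consumed BY NAME; scalar products (I.1.5) `HiggsLattice.siteInner`).  For the typed datum `D : Data14`
(coupling `C`, region `Ω^{(k)}`, `Ω = B^k(Ω^{(k)})`, background `A^{(k)}`, `m²(L^kε)² > 0`, `a_k ≥ 0`):
* `square_with_source` — COMPLETING THE SQUARE WITH A LINEAR SOURCE in the fluctuation variable `χ = φ′ − φ′₀`:
  `−½⟨χ, G_k^{−1}χ⟩ + ⟨φ′₀ + χ, f⟩ = −½⟨χ − G_kf, G_k^{−1}(χ − G_kf)⟩ + ⟨φ′₀, f⟩ + ½⟨f, G_kf⟩` (`G_k^{−1}G_kf = f`,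
  `B3Eq14*`/`HiggsCovariancePos.covOpK_propagatorK_apply`; symmetry of `G_k^{−1}`, `B1Eq230FluctCovPos.siteInner_covOpK_comm`);
* **`rt14_gaussian_source_eq`** — print's sentence FOR THE TYPED (1.4): for every observable `F` and every source `f` supported
  in `Ω`, `T[e^{−½⟨φ′,(−Δ^η_{A^{(k)},Ω}+m²(L^kε)²)φ′⟩} e^{⟨φ′,f⟩} F](φ)
   = ((a_k(L^kη)^{d−2}/2π)^{N/2})^{|Ω^{(k)}|} e^{−½⟨1φ,Δ^{(k)}(Ω,A^{(k)})1φ⟩} · e^{⟨φ′₀,f⟩ + ½⟨f,G_k(Ω,A^{(k)})f⟩}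
     · ∫dχ↾Ω e^{−½⟨χ,G_k(Ω,A^{(k)})^{−1}χ⟩} F(φ′₀ + G_k(Ω,A^{(k)})f + χ)`
  (`rt14_gaussian_eq`, the square completed with the source, and the translation of `∫dχ↾Ω` by `G_k(Ω,A^{(k)})f`, which is
  supported in `Ω` by `B3ScalarPropagatorMean.propagatorK_apply_of_not_mem`).
HONEST SCOPE.  As in `B3ScalarPropagatorMean`: the normalisation of the `χ`-Gaussian is not computed (both sides are the same
Bochner value for every `F`); the source is restricted to `Ω` (print's generating functional on the region); nothing about the
vertices (1.6)–(1.7).  Unit `lit-balaban-typer` gen 30 (literature-prover-lit-balaban-typer-g30-0); HOME/FILED.md records the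
proposal.
-/

open scoped BigOperators InnerProductSpace
open _root_.MeasureTheory

namespace Literature.MathematicalPhysics.QuantumFieldTheory.Balaban1983to89.B3ScalarPropagatorSource

open Literature.MathematicalPhysics.QuantumFieldTheory.Balaban1983to89.HiggsLattice
open Literature.MathematicalPhysics.QuantumFieldTheory.Balaban1983to89.HiggsAveraging
open Literature.MathematicalPhysics.QuantumFieldTheory.Balaban1983to89.HiggsCovariance
open Literature.MathematicalPhysics.QuantumFieldTheory.Balaban1983to89.HiggsCovariancePos
open Literature.MathematicalPhysics.QuantumFieldTheory.Balaban1983to89.HiggsCovarianceCont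
open Literature.MathematicalPhysics.QuantumFieldTheory.Balaban1983to89.HiggsFluctMeasure
open Literature.MathematicalPhysics.QuantumFieldTheory.Balaban1983to89.HiggsFluctMeasurePos
open Literature.MathematicalPhysics.QuantumFieldTheory.Balaban1983to89.B1Eq230FluctCov
open Literature.MathematicalPhysics.QuantumFieldTheory.Balaban1983to89.B1Eq230FluctCovPos
open Literature.MathematicalPhysics.QuantumFieldTheory.Balaban1983to89.B3Eq14AuxFunction
open Literature.MathematicalPhysics.QuantumFieldTheory.Balaban1983to89.B1RT
open Literature.MathematicalPhysics.QuantumFieldTheory.Balaban1983to89.B3ScalarPropagatorMean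

variable {P : HiggsLattice.Params} {N : ℕ} {k : ℕ} (D : Data14 P N k)

/-- **Completing the square with a linear source**, in the fluctuation variable `χ = φ′ − φ′₀`: for `G_k(Ω,A^{(k)})^{−1}`
(`covOpK`), `G_k(Ω,A^{(k)})` (`propagatorK`), `m²(L^kε)² > 0`, `a_k ≥ 0` and every `χ, φ′₀, f`,
`−½⟨χ, G_k^{−1}χ⟩ + ⟨φ′₀ + χ, f⟩ = −½⟨χ − G_kf, G_k^{−1}(χ − G_kf)⟩ + (⟨φ′₀, f⟩ + ½⟨f, G_kf⟩)` — the source shifts the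
mean by `G_k(Ω,A^{(k)})f` (`G_k^{−1}G_kf = f`, symmetry of `G_k^{−1}`). PROVED. [cite: Balaban1983Higgs3, §1 p.415] -/
theorem square_with_source (hm : 0 < D.m2 * D.ell ^ 2) (hak : 0 ≤ B1.aSeq D.a P.L k) (Ak : HiggsLattice.VecField P 0)
    (χ φ₀ f : ScalarField P 0 N) :
    -(1 / 2 : ℝ) * siteInner χ (covOpK D.C D.Ω Ak (D.m2 * D.ell ^ 2) D.a k χ) + siteInner (φ₀ + χ) f
      = -(1 / 2 : ℝ) * siteInner (χ - propagatorK D.C D.Ω Ak (D.m2 * D.ell ^ 2) D.a k f)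
            (covOpK D.C D.Ω Ak (D.m2 * D.ell ^ 2) D.a k (χ - propagatorK D.C D.Ω Ak (D.m2 * D.ell ^ 2) D.a k f))
        + (siteInner φ₀ f + (1 / 2 : ℝ) * siteInner f (propagatorK D.C D.Ω Ak (D.m2 * D.ell ^ 2) D.a k f)) := by
  -- `G_k^{-1} (G_k f) = f` and the symmetry of `G_k^{-1}`
  have hMg : covOpK D.C D.Ω Ak (D.m2 * D.ell ^ 2) D.a k (propagatorK D.C D.Ω Ak (D.m2 * D.ell ^ 2) D.a k f) = f := by
    rw [covOpK_propagatorK_apply D.C D.Ω Ak hm D.a k hak]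
  have hsym : siteInner (propagatorK D.C D.Ω Ak (D.m2 * D.ell ^ 2) D.a k f) (covOpK D.C D.Ω Ak (D.m2 * D.ell ^ 2) D.a k χ)
      = siteInner χ f := by
    rw [siteInner_covOpK_comm D.C D.Ω Ak (D.m2 * D.ell ^ 2) D.a k (propagatorK D.C D.Ω Ak (D.m2 * D.ell ^ 2) D.a k f) χ,
      hMg]
  -- the square
  have hsq : siteInner (χ - propagatorK D.C D.Ω Ak (D.m2 * D.ell ^ 2) D.a k f)
        (covOpK D.C D.Ω Ak (D.m2 * D.ell ^ 2) D.a k (χ - propagatorK D.C D.Ω Ak (D.m2 * D.ell ^ 2) D.a k f))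
      = siteInner χ (covOpK D.C D.Ω Ak (D.m2 * D.ell ^ 2) D.a k χ) - 2 * siteInner χ f
        + siteInner f (propagatorK D.C D.Ω Ak (D.m2 * D.ell ^ 2) D.a k f) := by
    rw [map_sub, siteInner_sub_right,
      siteInner_comm (χ - propagatorK D.C D.Ω Ak (D.m2 * D.ell ^ 2) D.a k f) (covOpK D.C D.Ω Ak (D.m2 * D.ell ^ 2) D.a k χ),
      siteInner_comm (χ - propagatorK D.C D.Ω Ak (D.m2 * D.ell ^ 2) D.a k f)
        (covOpK D.C D.Ω Ak (D.m2 * D.ell ^ 2) D.a k (propagatorK D.C D.Ω Ak (D.m2 * D.ell ^ 2) D.a k f)),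
      siteInner_sub_right, siteInner_sub_right, hMg, siteInner_comm (covOpK D.C D.Ω Ak (D.m2 * D.ell ^ 2) D.a k χ) χ,
      siteInner_comm (covOpK D.C D.Ω Ak (D.m2 * D.ell ^ 2) D.a k χ) (propagatorK D.C D.Ω Ak (D.m2 * D.ell ^ 2) D.a k f),
      hsym, siteInner_comm f χ]
    ring
  rw [hsq, siteInner_comm (φ₀ + χ) f, siteInner_add_right, siteInner_comm f φ₀, siteInner_comm f χ]
  ring

/-- **«we can easily add the field G_k(Ω, B̃)f coming from external sources in the generating functional»** (p. 415) FOR THE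
TYPED (1.4): with a source `f` supported in `Ω`, the transformation of the Gaussian density times `e^{⟨φ′,f⟩}F(φ′)` is
`((a_k(L^kη)^{d−2}/2π)^{N/2})^{|Ω^{(k)}|} e^{−½⟨1φ,Δ^{(k)}(Ω,A^{(k)})1φ⟩} · e^{⟨φ′₀,f⟩ + ½⟨f,G_k(Ω,A^{(k)})f⟩}
 · ∫dχ↾Ω e^{−½⟨χ,G_k(Ω,A^{(k)})^{−1}χ⟩} F(φ′₀ + G_k(Ω,A^{(k)})f + χ)`:
the external scalar field becomes `φ′₀ + G_k(Ω,A^{(k)})f = a_k(L^kη)^{−2}G_k(Ω,A^{(k)})Q_k^*(A^{(k)})1φ + G_k(Ω,A^{(k)})f`.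
`m²(L^kε)² > 0`, `a_k ≥ 0`. PROVED (`rt14_gaussian_eq`, the square completed with the source, translation of `∫dχ↾Ω` by
`G_k(Ω,A^{(k)})f`, which is supported in `Ω`). [cite: Balaban1983Higgs3, §1 p.415] -/
theorem rt14_gaussian_source_eq (hm : 0 < D.m2 * D.ell ^ 2) (hak : 0 ≤ B1.aSeq D.a P.L k) (Ak : HiggsLattice.VecField P 0)
    (A' : (j : Fin k) → HiggsLattice.VecField P j) (φ : ScalarField P k N) (F : ScalarField P 0 N → ℝ)
    {f : ScalarField P 0 N} (hf : ∀ x, x ∉ D.Ω → f x = 0) :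
    D.rt14 Ak 0 A' (fun φ' => Real.exp (-(1 / 2 : ℝ) * siteInner φ' (D.scalarOp Ak 0 A' φ'))
        * (Real.exp (siteInner φ' f) * F φ')) φ
      = ((prec (B1.aSeq D.a P.L k) (P.mesh k) P.d / (2 * Real.pi)) ^ ((N : ℝ) / 2)) ^ D.Ωk.card
        * Real.exp (-(1 / 2 : ℝ) *
            (coeff221 P D.a k * siteInner (fun y => if y ∈ D.Ωk then φ y else 0) (fun y => if y ∈ D.Ωk then φ y else 0)
              - coeff221 P D.a k ^ 2 * siteInner (avgQkAdj D.C Ak k fun y => if y ∈ D.Ωk then φ y else 0)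
                  (propagatorK D.C D.Ω Ak (D.m2 * D.ell ^ 2) D.a k
                    (avgQkAdj D.C Ak k fun y => if y ∈ D.Ωk then φ y else 0))))
        * (Real.exp (siteInner (coeff221 P D.a k • propagatorK D.C D.Ω Ak (D.m2 * D.ell ^ 2) D.a k
                (avgQkAdj D.C Ak k fun y => if y ∈ D.Ωk then φ y else 0)) f
              + (1 / 2 : ℝ) * siteInner f (propagatorK D.C D.Ω Ak (D.m2 * D.ell ^ 2) D.a k f))
          * ∫ χΩ : ↥D.Ω → EuclideanSpace ℝ (Fin N),
              Real.exp (-(1 / 2 : ℝ) * siteInner (extendZero D.Ω χΩ)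
                  (covOpK D.C D.Ω Ak (D.m2 * D.ell ^ 2) D.a k (extendZero D.Ω χΩ)))
                * F (coeff221 P D.a k • propagatorK D.C D.Ω Ak (D.m2 * D.ell ^ 2) D.a k
                      (avgQkAdj D.C Ak k fun y => if y ∈ D.Ωk then φ y else 0)
                    + propagatorK D.C D.Ω Ak (D.m2 * D.ell ^ 2) D.a k f + extendZero D.Ω χΩ)) := by
  -- `G_k(Ω,A^{(k)})f` is supported in `Ω`
  have hgsupp : ∀ x, x ∉ D.Ω → propagatorK D.C D.Ω Ak (D.m2 * D.ell ^ 2) D.a k f x = 0 := fun x hx => by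
    have h := propagatorK_apply_of_not_mem D.C Ak D.Ωk (D.m2 * D.ell ^ 2) D.a hm hak hf hx
    rw [show region k D.Ωk = D.Ω from rfl] at h
    exact h
  rw [rt14_gaussian_eq D hm hak Ak A' φ]
  congr 1
  set φ₀ : ScalarField P 0 N := coeff221 P D.a k • propagatorK D.C D.Ω Ak (D.m2 * D.ell ^ 2) D.a k
    (avgQkAdj D.C Ak k fun y => if y ∈ D.Ωk then φ y else 0) with hφ₀
  set g : ScalarField P 0 N := propagatorK D.C D.Ω Ak (D.m2 * D.ell ^ 2) D.a k f with hg
  set gΩ : ↥D.Ω → EuclideanSpace ℝ (Fin N) := fun x => g x.1 with hgΩ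
  have hext : extendZero D.Ω gΩ = g := by
    funext x
    by_cases hx : x ∈ D.Ω
    · rw [extendZero_of_mem _ _ hx]
    · rw [extendZero_of_not_mem _ _ hx, hgsupp x hx]
  -- complete the square with the source, pointwise under the integral
  have hpt : ∀ χΩ : ↥D.Ω → EuclideanSpace ℝ (Fin N),
      Real.exp (-(1 / 2 : ℝ) * siteInner (extendZero D.Ω χΩ)
          (covOpK D.C D.Ω Ak (D.m2 * D.ell ^ 2) D.a k (extendZero D.Ω χΩ)))
        * (Real.exp (siteInner (φ₀ + extendZero D.Ω χΩ) f) * F (φ₀ + extendZero D.Ω χΩ))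
        = Real.exp (siteInner φ₀ f + (1 / 2 : ℝ) * siteInner f g)
          * (Real.exp (-(1 / 2 : ℝ) * siteInner (-g + extendZero D.Ω χΩ)
              (covOpK D.C D.Ω Ak (D.m2 * D.ell ^ 2) D.a k (-g + extendZero D.Ω χΩ)))
            * F (φ₀ + g + (-g + extendZero D.Ω χΩ))) := by
    intro χΩ
    have hs : -(1 / 2 : ℝ) * siteInner (extendZero D.Ω χΩ)
          (covOpK D.C D.Ω Ak (D.m2 * D.ell ^ 2) D.a k (extendZero D.Ω χΩ)) + siteInner (φ₀ + extendZero D.Ω χΩ) f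
        = -(1 / 2 : ℝ) * siteInner (-g + extendZero D.Ω χΩ)
            (covOpK D.C D.Ω Ak (D.m2 * D.ell ^ 2) D.a k (-g + extendZero D.Ω χΩ))
          + (siteInner φ₀ f + (1 / 2 : ℝ) * siteInner f g) := by
      rw [neg_add_eq_sub]
      exact square_with_source D hm hak Ak (extendZero D.Ω χΩ) φ₀ f
    rw [← mul_assoc, ← Real.exp_add, hs, add_comm (-(1 / 2 : ℝ) * _) (siteInner φ₀ f + _), Real.exp_add, mul_assoc,
      show φ₀ + g + (-g + extendZero D.Ω χΩ) = φ₀ + extendZero D.Ω χΩ by abel]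
  simp_rw [hpt]
  rw [integral_const_mul]
  congr 1
  -- translate `χ ↦ G_kf + χ` (translation invariance of `∫dχ↾Ω`)
  rw [← integral_add_left_eq_self _ gΩ]
  refine integral_congr_ae (Filter.Eventually.of_forall fun χΩ => ?_)
  simp only [extendZero_add, hext, neg_add_cancel_left]

end Literature.MathematicalPhysics.QuantumFieldTheory.Balaban1983to89.B3ScalarPropagatorSource
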